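import Summits.BirchSwinnertonDyer.Rank1Residual.GaloisImage.MultiplicativeCartanNormalizer
import Summits.BirchSwinnertonDyer.Rank1Residual.P2.CMKolyvaginRationalDescentPlumbingAtTwo
import Literature.NumberTheory.EllipticCurves.HeegnerPointsKolyvaginCebotarevProofs
import HarnessLib

/-!
# Route `ErratumRoadFive` (rung K2), crux `NonSurjCorner` (item stmt-BirchSwinnertonDyer-19065), line `Lines/hybrid.lean`, r23 slot 6‴ (K-disjointness):
# step (b) — at a multiplicative `p` unramified in `K`, the INERTIA IMAGE is a split half-Cartan INSIDE the image of `Γ_K`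
# (cell `bsd-stepL`, seat `bsd-stepL-corner-p1` g18; `--supports stmt-BirchSwinnertonDyer-19065 --as helper`)

WHY THIS FILE. Step (b) of the (K) plan (memo CORNER-G18 §6″): for `E/ℚ` multiplicative at `p ≠ 2` with `p ∤ |ρ̄_{E,p}(Γ_ℚ)|` and `K` a quadratic field
with `p ∤ d_K`, in any frame `Φ` and at any prime `𝔏` of `ℤ̄` above `p`: `Φ(ρ̄(I_𝔏))` is a split half-Cartan subgroup `P₁ (1 0; 0 *) P₁⁻¹`
(`GaloisImage.exists_halfSplitCartan_eq_inertia_image_of_mult`, lane B) and lies inside `Φ(ρ̄(res Γ_K))` (`I_𝔏 ≤ res Γ_K` because `p` is unramified in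
`K`: `RationalDescentPlumbing.isUnramifiedIn_of_not_dvd_discr` + `inertia_le_range_absGaloisRestrict_of_isUnramifiedIn`). Together with
`…AuxPrimeKDisjointPrelims` (steps (a), (c)) only the Frobenius step (d) of (K) remains.
* `AuxPrimeSupplyCorner.exists_halfSplitCartan_le_image_rangeK_of_mult_of_not_dvd_discr`.

HONEST FRAMING: ONE THEOREM (no definition, no named fact, no `sorry`); Galois bookkeeping; nothing about any curve's BSD; 19065 NOT closed; T7.
References (locators only): [cite: Serre1972, §1.11–1.12, §2.1 a)] [cite: NeukirchANT1999, Ch. III §2, Cor. (2.12)].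
-/

noncomputable section

set_option autoImplicit false
set_option linter.dupNamespace false -- `Summit.BirchSwinnertonDyer.BirchSwinnertonDyer` (summit = problem), tree-wide

open scoped Classical NumberField MatrixGroups
open WeierstrassCurve NumberField Field IsDedekindDomain Matrix
open Literature.NumberTheory.GaloisRepresentations Literature.NumberTheory.GaloisRepresentations.Serre1972
open Literature.NumberTheory.EllipticCurves Literature.NumberTheory.EllipticCurves.Rank1Residual
open Summit.BirchSwinnertonDyer.Rank1Residual Rat.HeightOneSpectrum

namespace Summit.BirchSwinnertonDyer.BirchSwinnertonDyer.Theorems.AuxPrimeSupplyCorner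

/-- **Step (b) of K-disjointness: the inertia image at a multiplicative `p ∤ d_K` is a split half-Cartan inside `Φ(ρ̄(res Γ_K))`.**
[cite: Serre1972, §1.12, §2.1 a)] [cite: NeukirchANT1999, Ch. III (2.12)] -/
theorem exists_halfSplitCartan_le_image_rangeK_of_mult_of_not_dvd_discr (W : WeierstrassCurve ℚ) [W.IsElliptic]
    {K : Type} [Field K] [NumberField K] (hK : IsImaginaryQuadratic K) (p : ℕ) [Fact p.Prime] (hp2 : p ≠ 2)
    (hmult : Mult W p) (hdK : ¬ (p : ℤ) ∣ NumberField.discr K)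
    (Φ : Multiplicative (AddAut (geomTorsion W p)) ≃* GL (Fin 2) (ZMod p))
    (e : geomTorsion W p ≃+ (Fin 2 → ZMod p))
    (he : ∀ (g : Multiplicative (AddAut (geomTorsion W p))) (x : geomTorsion W p),
      e (Multiplicative.toAdd g x) = ((Φ g : GL (Fin 2) (ZMod p)) : Matrix (Fin 2) (Fin 2) (ZMod p)) *ᵥ e x)
    (hG : ¬ p ∣ Nat.card ((galoisRepTorsion W p).range.map Φ.toMonoidHom))
    {v : HeightOneSpectrum (𝓞 ℚ)} (hv : (primesEquiv v : ℕ) = p)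
    {𝔏 : Ideal (absIntegers (𝓞 ℚ) ℚ)} (h𝔏 : 𝔏 ∈ v.primesAbove) :
    ∃ P₁ : GL (Fin 2) (ZMod p),
      ((𝔏.inertia (absoluteGaloisGroup ℚ)).map (galoisRepTorsion W p)).map Φ.toMonoidHom = halfSplitCartan P₁ ∧
      halfSplitCartan P₁ ≤ ((absGaloisRestrict ℚ K).range.map (galoisRepTorsion W p)).map Φ.toMonoidHom := by
  haveI : Algebra.IsQuadraticExtension ℚ K := ⟨hK.1⟩
  obtain ⟨P₁, hP₁⟩ := GaloisImage.exists_halfSplitCartan_eq_inertia_image_of_mult W p Φ e he hp2 hmult hG hv h𝔏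
  have hunr : Algebra.IsUnramifiedIn (𝓞 K) v.asIdeal :=
    P2.RationalDescentPlumbing.isUnramifiedIn_of_not_dvd_discr v (by rw [hv]; exact hdK)
  refine ⟨P₁, hP₁, ?_⟩
  rw [← hP₁]
  exact Subgroup.map_mono (Subgroup.map_mono (inertia_le_range_absGaloisRestrict_of_isUnramifiedIn hunr h𝔏))

end Summit.BirchSwinnertonDyer.BirchSwinnertonDyer.Theorems.AuxPrimeSupplyCorner

end
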